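import Summits.QuantumFields.YangMills.Theorems.BalabanLadderNTTwoPointFloor
import Summits.QuantumFields.YangMills.Theorems.BalabanLadderNTSharpTwoPointCeiling
import Summits.QuantumFields.YangMills.Theorems.LangevinControlUVOSLegsFromFemtoAndGapStubCollar
import Literature.MathematicalPhysics.QuantumLattice.LatticeGaugeDLRCovarianceSplit
import HarnessLib

/-!
# Crux `NT` (stmt-QuantumFields-19353): the two-point floor in the NT LETTERS — `c/β² ≤ torusCov_{T,β}(x, x) = Var_{T,β}(A_x)`
# and `c/β² ≤ Var_{T,β}(S_e)`, uniformly in the volume (hypothesis-free)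

Fleet lead prover of crux `NT` (unit `ym-spine-19353-p1`, g30).  Sequel of `Theorems/BalabanLadderNTTwoPointFloor`.  The kernel of
the crux's clause-(i) functional is the torus covariance of the action densities, `Q2_{β,L,s}(f, g) = Σ_{x,y} f(sx) g(sy)
torusCov_{T,β}(x, y)` (`RunningCoupling.Q2_eq_sum_torusCov`); g28 landed its sharp CEILING `|torusCov_{T,β}(x, y)| ≤ W/β²`
(`SharpCeilings.exists_abs_torusCov_dens_le_sharp`).  Here is the FLOOR on the diagonal:

* §1 the action density `A_x = Σ_q Re tr r(U_{(x,q)})` of `ℤ⁴` as a sum of the six plaquette observables based at `x`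
  (`dens_eq_sum_plaquetteObs`; continuity and the bound `|A_x| ≤ 6N` are the tree's `DlrCollarTransfer.continuous_dens`,
  `abs_curvature_le`) and its affine dependence on the link `e = (x, 0)` (`six_mul_sub_dens_update`): the three
  plaquettes `(x; 0, j)` pass through `e` (staple family of size `3`), the three `(x; i, j)`, `0 < i`, do not;
* §2 **`exists_torusCov_dens_diag_ge`: `c/β² ≤ torusCov_{T,β}(x, x)`** for all `β ≥ β₀`, all odd tori `2L+1 ≥ 5`, all sites —
  torus DLR at `e = (x, 0)`, the one-link kernel variance floor on the good exteriors (`kernel_variance_floor`), the rarity of the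
  bad ones (`exists_good_exteriors`); with g28's ceiling the **two-sided pin `c/β² ≤ torusCov_{T,β}(x, x) ≤ W/β²`**
  (`torusCov_dens_diag_pin_of_simple`);
* §3 `exists_torusVar_linkAction_ge`: the link action `S_e` (six plaquettes through a link) has `Var_{T,β}(S_e) ≥ c/β²` likewise.

HONEST FRAMING.  Coincident-point (lattice-scale) two-point floors = tree-level lattice perturbation theory made rigorous and
volume-uniform; NT's clause (i) needs the floor at separations `≍ a(β)⁻¹ → ∞` in lattice units (dimensional transmutation), about
which nothing is said.  NT is NOT proved; the Yang–Mills mass gap is NOT proved; not Clay.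
Refs: Seiler LNP 159 Ch. 2 (DLR); Montvay–Münster 1994 §3.2.
-/

set_option autoImplicit false

noncomputable section

open scoped Matrix Matrix.Norms.Frobenius ENNReal NNReal Topology BigOperators
open MeasureTheory Measure Filter Set ProbabilityTheory
open Literature.MathematicalPhysics.QuantumLattice
open Literature.MathematicalPhysics.QuantumFieldTheory hiding ZdEdge
open Summit.QuantumFields.YangMills.Theorems.FreeEnergyLogCoefficient (dimE)
open Summit.QuantumFields.YangMills.Cruxes.OSLegsFromFemtoAndGap.DlrCollarTransfer (torusE dens continuous_dens)
open Summit.QuantumFields.YangMills.Cruxes.IR.AfOnset (dens_torusLift_eq)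
open Summit.QuantumFields.YangMills.Theorems.TunedSequenceExists.Negative.Freezing (plaquetteHolonomyZd_configShift)
open Summit.QuantumFields.YangMills.Theorems.CurvatureBoostCovariance.Negative (card_planes)

namespace Summit.QuantumFields.YangMills.Cruxes.NT.LinkEquipartition

variable (G : Type) [Group G] [TopologicalSpace G] [IsTopologicalGroup G] [CompactSpace G]
  [MeasurableSpace G] [BorelSpace G] (r : LatticeRep G)

/-! ## §1 The action density of `ℤ⁴` at `x` and its dependence on the link `(x, 0)` -/

section Density

/-- **Dictionary**: `A_x(U) = Σ_q Re tr r(U_{(x, q)})` over the six orientations (tree `actionDensity_eq_sum_subtype`,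
`plaquetteHolonomyZd_configShift`). [folklore] -/
theorem dens_eq_sum_plaquetteObs (x : Fin 4 → ℤ) (U : LGConfig 4 G) :
    dens G r x U = ∑ q : {q : Fin 4 × Fin 4 // q.1 < q.2}, plaquetteObs r.ρ x q.1.1 q.1.2 U := by
  show r.curvature.F (configShift (-x) U) = _
  rw [show r.curvature.F = actionDensity r.ρ from rfl, actionDensity_eq_sum_subtype]
  refine Finset.sum_congr rfl fun q _ => ?_
  unfold plaquetteObs
  rw [plaquetteHolonomyZd_configShift, sub_neg_eq_add, zero_add]

/-- The action density at `x` depends only on the edges of the six plaquettes based at `x`. [folklore] -/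
theorem isCylinder_dens (x : Fin 4 → ℤ) :
    IsCylinder (dens G r x) (Finset.univ.biUnion fun q : {q : Fin 4 × Fin 4 // q.1 < q.2} => plaquetteEdges ((x, q) : ZdPlaquette 4)) := by
  intro U V h
  rw [dens_eq_sum_plaquetteObs, dens_eq_sum_plaquetteObs]
  refine Finset.sum_congr rfl fun q _ => ?_
  exact isCylinder_plaquetteObs r.ρ ((x, q) : ZdPlaquette 4) fun e' he' =>
    h e' (Finset.mem_biUnion.2 ⟨q, Finset.mem_univ _, he'⟩)

/-- **The action density is affine in the link `e = (x, 0)`**: `6N − A_x(ω^{e ← g}) = u_{k'}(g) + K(ω)` with the three staples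
`k'_q = staple_{(x,q)}^e(ω)` of the plaquettes `(x; 0, j)` and `K(ω)` the cost of the three plaquettes `(x; i, j)`, `0 < i`, which
do not contain `e`. [folklore] -/
theorem six_mul_sub_dens_update [DecidableEq (ZdEdge 4)] (x : Fin 4 → ℤ) (ω : LGConfig 4 G) (g : G) :
    6 * (r.N : ℝ) - dens G r x (Function.update ω ((x, (0 : Fin 4)) : ZdEdge 4) g) =
      linkCost r.ρ (fun q : {q : {q : Fin 4 × Fin 4 // q.1 < q.2} // q.1.1 = 0} => staple ((x, q.1) : ZdPlaquette 4) ((x, (0 : Fin 4)) : ZdEdge 4) ω) g +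
        ∑ q ∈ Finset.univ.filter (fun q : {q : Fin 4 × Fin 4 // q.1 < q.2} => q.1.1 ≠ 0),
          ((r.N : ℝ) - plaquetteObs r.ρ x q.1.1 q.1.2 ω) := by
  set e : ZdEdge 4 := (x, (0 : Fin 4)) with he
  have hsix : 6 * (r.N : ℝ) - dens G r x (Function.update ω e g) =
      ∑ q : {q : Fin 4 × Fin 4 // q.1 < q.2}, ((r.N : ℝ) - plaquetteObs r.ρ x q.1.1 q.1.2 (Function.update ω e g)) := by
    rw [dens_eq_sum_plaquetteObs, Finset.sum_sub_distrib, Finset.sum_const, Finset.card_univ,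
      card_planes, nsmul_eq_mul]
    norm_num
  rw [hsix, ← Finset.sum_filter_add_sum_filter_not Finset.univ (fun q : {q : Fin 4 × Fin 4 // q.1 < q.2} => q.1.1 = 0)]
  congr 1
  · -- the three plaquettes through `e`: affine in the link
    rw [linkCost, Finset.sum_subtype (Finset.univ.filter fun q : {q : Fin 4 × Fin 4 // q.1 < q.2} => q.1.1 = 0)
      (p := fun q : {q : Fin 4 × Fin 4 // q.1 < q.2} => q.1.1 = 0) (fun q => by simp)]
    refine Finset.sum_congr rfl fun q _ => ?_
    have hep : e ∈ plaquetteEdges ((x, q.1) : ZdPlaquette 4) := by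
      have hq : q.1.1.1 = 0 := q.2
      simp [plaquetteEdges, he, hq]
    have h := sub_plaquetteObs_update_eq_linkCost r.ρ r.mem_unitary hep ω g
    rw [add_zero, linkCost] at h
    simpa using h
  · -- the three plaquettes not through `e`: unchanged
    refine Finset.sum_congr rfl fun q hq => ?_
    rw [Finset.mem_filter] at hq
    have hq0 : q.1.1 ≠ 0 := hq.2
    have hq1 : q.1.2 ≠ 0 := by
      intro h0
      have hlt : q.1.1 < q.1.2 := q.2
      rw [h0] at hlt
      exact (Fin.not_lt_zero _ ) hlt
    congr 1
    refine isCylinder_plaquetteObs r.ρ ((x, q) : ZdPlaquette 4) fun e' he' => ?_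
    have hne : e' ≠ e := by
      intro hee
      rw [Finset.mem_coe, plaquetteEdges_eq] at he'
      simp only [Finset.mem_insert, Finset.mem_singleton] at he'
      rcases he' with rfl | rfl | rfl | rfl <;>
        simp [plaqLink1, plaqLink2, plaqLink3, plaqLink4, he, Prod.ext_iff, hq0, hq1] at hee
    exact Function.update_of_ne hne _ _

omit [IsTopologicalGroup G] [CompactSpace G] [MeasurableSpace G] [BorelSpace G] in
/-- The electric part of the action density cost at the actual link value is at most the link action `S_{(x,0)}`. [folklore] -/
theorem linkCost_electric_le_linkAction [DecidableEq (ZdEdge 4)] (x : Fin 4 → ℤ) (ω : LGConfig 4 G) :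
    linkCost r.ρ (fun q : {q : {q : Fin 4 × Fin 4 // q.1 < q.2} // q.1.1 = 0} => staple ((x, q.1) : ZdPlaquette 4) ((x, (0 : Fin 4)) : ZdEdge 4) ω) (ω (x, (0 : Fin 4))) ≤
      wilsonBoundaryAction r.ρ {((x, (0 : Fin 4)) : ZdEdge 4)} ω := by
  set e : ZdEdge 4 := (x, (0 : Fin 4)) with he
  have hep : ∀ q : {q : {q : Fin 4 × Fin 4 // q.1 < q.2} // q.1.1 = 0}, e ∈ plaquetteEdges ((x, q.1) : ZdPlaquette 4) := by
    intro q
    have hq : q.1.1.1 = 0 := q.2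
    simp [plaquetteEdges, he, hq]
  -- each term is the cost of the plaquette `(x, q)` at `ω`
  have hterm : ∀ q : {q : {q : Fin 4 × Fin 4 // q.1 < q.2} // q.1.1 = 0}, (r.N : ℝ) - (r.ρ (ω e * staple ((x, q.1) : ZdPlaquette 4) e ω)).trace.re =
      (r.N : ℝ) - plaquetteObs r.ρ x q.1.1.1 q.1.1.2 ω := by
    intro q
    have h := sub_plaquetteObs_update_eq_linkCost r.ρ r.mem_unitary (hep q) ω (ω e)
    rw [Function.update_eq_self, add_zero, linkCost] at h
    simpa using h.symm
  unfold linkCost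
  simp only [hterm]
  -- reindex by the injection `q ↦ (x, q)` into the plaquettes through `e`
  set ι : {q : {q : Fin 4 × Fin 4 // q.1 < q.2} // q.1.1 = 0} → ZdPlaquette 4 := fun q => (x, q.1) with hι
  have hιinj : Function.Injective ι := by
    intro a b hab
    simp only [hι, Prod.mk.injEq, true_and] at hab
    exact Subtype.ext hab
  have hsum : ∑ q : {q : {q : Fin 4 × Fin 4 // q.1 < q.2} // q.1.1 = 0}, ((r.N : ℝ) - plaquetteObs r.ρ x q.1.1.1 q.1.1.2 ω) =
      ∑ p' ∈ Finset.univ.map ⟨ι, hιinj⟩, ((r.N : ℝ) - plaquetteObs r.ρ p'.1 p'.2.1.1 p'.2.1.2 ω) := by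
    rw [Finset.sum_map]
    rfl
  rw [hsum]
  unfold wilsonBoundaryAction
  refine Finset.sum_le_sum_of_subset_of_nonneg
    (f := fun p' : ZdPlaquette 4 => (r.N : ℝ) - plaquetteObs r.ρ p'.1 p'.2.1.1 p'.2.1.2 ω) ?_ fun p' _ _ => ?_
  · intro p' hp'
    obtain ⟨q, _, rfl⟩ := Finset.mem_map.1 hp'
    exact mem_plaquettesTouching_singleton.2 (hep q)
  · have h := abs_le.1 (abs_plaquetteObs_le_holds r.ρ r.mem_unitary p'.1 p'.2.1.1 p'.2.1.2 ω)
    linarith [h.2]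

end Density

/-! ## §2 The floor `c/β² ≤ torusCov_{T,β}(x, x)` and the two-sided pin -/

section TorusCov

set_option maxHeartbeats 400000 in
/-- **THE TWO-POINT FLOOR IN THE NT LETTERS, uniformly in the volume**: there are `c, β₀ > 0` (depending on `(G, r)` only) with
`c/β² ≤ torusCov_{T,β}(x, x) = Var_{T,β}(A_x)` for every `β ≥ β₀`, every odd torus `2L+1 ≥ 5` and every site `x` — the diagonal of
the kernel of `Q2` is bounded BELOW at the Gaussian scale. [folklore] -/
theorem exists_torusCov_dens_diag_ge (hD : 0 < dimE r.ρ) :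
    ∃ c β₀ : ℝ, 0 < c ∧ 0 < β₀ ∧ ∀ β : ℝ, β₀ ≤ β → ∀ (L : ℕ), 2 ≤ L → ∀ x : Fin 4 → ℤ,
      c / β ^ 2 ≤ torusE G r β L (fun U => dens G r x U * dens G r x U) - torusE G r β L (dens G r x) * torusE G r β L (dens G r x) := by
  classical
  haveI := r.secondCountableTopology
  obtain ⟨θ, hθ0, hgood⟩ := exists_good_exteriors G r
  obtain ⟨κ, β₁, hκ, hβ₁, hker⟩ := kernel_variance_floor r.ρ r.continuous r.injective r.mem_unitary hD θ hθ0.le 6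
  refine ⟨κ / 2, max β₁ 4, by positivity, lt_of_lt_of_le hβ₁ (le_max_left _ _), fun β hβ L hL x => ?_⟩
  have hββ₁ : β₁ ≤ β := (le_max_left _ _).trans hβ
  have hβ4 : 4 ≤ β := (le_max_right _ _).trans hβ
  haveI : NeZero (2 * L + 1) := ⟨by omega⟩
  set μT := wilsonMeasure (d := 4) (L := 2 * L + 1) (G := G) r.ρ β with hμT
  haveI : IsProbabilityMeasure μT := isProbabilityMeasure_wilsonMeasure (d := 4) (L := 2 * L + 1) r.ρ r.continuous β
  set e : ZdEdge 4 := (x, (0 : Fin 4)) with he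
  -- the observable `F = 6N − A_x` and the torus mean
  set F : LGConfig 4 G → ℝ := fun U => 6 * (r.N : ℝ) - dens G r x U with hF
  have hFcont : Continuous F := continuous_const.sub (continuous_dens r x)
  have hFbd : ∀ U, |F U| ≤ 12 * r.N := by
    intro U
    have hd : |dens G r x U| ≤ 6 * r.N := abs_curvature_le r _
    have h := abs_le.1 hd
    rw [hF, abs_le]; constructor <;> linarith [h.1, h.2]
  have hFcyl : IsCylinder F (Finset.univ.biUnion fun q : {q : Fin 4 × Fin 4 // q.1 < q.2} =>
      plaquetteEdges ((x, q) : ZdPlaquette 4)) := by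
    intro U V h
    simp only [hF]
    rw [isCylinder_dens G r x h]
  obtain ⟨mD, hmD⟩ : ∃ m : ℝ, m = ∫ U, dens G r x (torusLift (2 * L + 1) U) ∂μT := ⟨_, rfl⟩
  have hDm : Measurable fun U : GaugeConfig 4 (2 * L + 1) G => dens G r x (torusLift (2 * L + 1) U) :=
    ((continuous_dens r x).comp (continuous_torusLift _)).measurable
  have hDbd : ∀ U : GaugeConfig 4 (2 * L + 1) G, |dens G r x (torusLift (2 * L + 1) U)| ≤ 6 * r.N :=
    fun U => abs_curvature_le r _
  have hmDabs : |mD| ≤ 6 * r.N := by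
    have h := norm_integral_le_of_norm_le_const (μ := μT) (f := fun U => dens G r x (torusLift (2 * L + 1) U))
      (C := 6 * r.N) (ae_of_all _ fun U => by rw [Real.norm_eq_abs]; exact hDbd U)
    rw [hmD]
    simpa [Real.norm_eq_abs] using h
  have hcabs : |6 * (r.N : ℝ) - mD| ≤ 12 * r.N := by
    have h := abs_le.1 hmDabs
    rw [abs_le]; constructor <;> linarith [h.1, h.2]
  -- the window
  have hwin : ∀ e' ∈ ({e} : Finset (ZdEdge 4)) ∪ Finset.univ.biUnion (fun q : {q : Fin 4 × Fin 4 // q.1 < q.2} =>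
      plaquetteEdges ((x, q) : ZdPlaquette 4)), ∀ j, (x j - 2) + 1 ≤ e'.1 j ∧ e'.1 j + 2 ≤ (x j - 2) + ((2 * L + 1 : ℕ) : ℤ) := by
    intro e' he' j
    rcases Finset.mem_union.1 he' with h1 | h2
    · exact window_of_touching hL x 0 e' (Finset.mem_union_left _ h1) j
    · obtain ⟨q, _, hq⟩ := Finset.mem_biUnion.1 h2
      refine window_of_touching hL x q.1.1 e' (Finset.mem_union_right _ (Finset.mem_biUnion.2 ⟨(x, q), ?_, hq⟩)) j
      exact mem_plaquettesTouching_singleton.2 (by simp [plaquetteEdges])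
  -- the kernel floor on the good exteriors
  have hcard : (plaquettesTouching {e}).card ≤ 6 := (card_plaquettesTouching_singleton_le e).trans (by norm_num)
  haveI : Nonempty {q : {q : Fin 4 × Fin 4 // q.1 < q.2} // q.1.1 = 0} := ⟨⟨⟨((0 : Fin 4), (1 : Fin 4)), by decide⟩, rfl⟩⟩
  have hcardE : Fintype.card {q : {q : Fin 4 × Fin 4 // q.1 < q.2} // q.1.1 = 0} ≤ 6 :=
    (Fintype.card_subtype_le _).trans_eq card_planes
  have hfloor : ∀ U ∈ {U : GaugeConfig 4 (2 * L + 1) G |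
      wilsonBoundaryAction r.ρ {e} (torusLift (2 * L + 1) U) ≤ θ / β ∧
        ∫ V, wilsonBoundaryAction r.ρ {e} V ∂(ymSpecification r.ρ β {e} (torusLift (2 * L + 1) U)) ≤ θ / β},
      κ / β ^ 2 ≤ ∫ V, (F V - (6 * (r.N : ℝ) - mD)) ^ 2 ∂(ymSpecification r.ρ β {e} (torusLift (2 * L + 1) U)) := by
    intro U hU
    set ω := torusLift (2 * L + 1) U with hω
    refine hker β hββ₁ e ω (plaquettesTouching_singleton_nonempty e) hcard {q : {q : Fin 4 × Fin 4 // q.1 < q.2} // q.1.1 = 0}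
      (fun q : {q : {q : Fin 4 × Fin 4 // q.1 < q.2} // q.1.1 = 0} => staple ((x, q.1) : ZdPlaquette 4) e ω) hcardE F _ hFcont.measurable
      (fun g => six_mul_sub_dens_update G r x ω g) hU.1 ((linkCost_electric_le_linkAction G r x ω).trans hU.1) hU.2 _
  have hGm : MeasurableSet {U : GaugeConfig 4 (2 * L + 1) G |
      wilsonBoundaryAction r.ρ {e} (torusLift (2 * L + 1) U) ≤ θ / β ∧
        ∫ V, wilsonBoundaryAction r.ρ {e} V ∂(ymSpecification r.ρ β {e} (torusLift (2 * L + 1) U)) ≤ θ / β} :=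
    ((isClosed_le ((continuous_wilsonBoundaryAction r.ρ r.continuous {e}).comp (continuous_torusLift _))
        continuous_const).inter
      (isClosed_le ((continuous_integral_ymSpecification r.ρ r.continuous β {e}
        (continuous_wilsonBoundaryAction r.ρ r.continuous {e})
        (abs_wilsonBoundaryAction_singleton_le r.ρ r.mem_unitary e)).comp (continuous_torusLift _))
        continuous_const)).measurableSet
  have hmain := torus_integral_ge_of_good G r e hFcont hFbd hFcyl (fun j => x j - 2) hwin (6 * (r.N : ℝ) - mD) hcabs hκ.le
    hGm (hgood L hL β hβ4 x 0) hfloor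
  -- `torusCov(x,x) = ∫ (A_x − mD)² = ∫ (F − (6N − mD))²`
  have hvar := integral_sq_sub_integral_eq μT hDm hDbd
  rw [← hmD] at hvar
  have hsq : ∀ U : GaugeConfig 4 (2 * L + 1) G,
      (F (torusLift (2 * L + 1) U) - (6 * (r.N : ℝ) - mD)) ^ 2 = (dens G r x (torusLift (2 * L + 1) U) - mD) ^ 2 := by
    intro U; simp only [hF]; ring
  have h1 : ∫ U, (F (torusLift (2 * L + 1) U) - (6 * (r.N : ℝ) - mD)) ^ 2 ∂μT =
      ∫ U, (dens G r x (torusLift (2 * L + 1) U) - mD) ^ 2 ∂μT := integral_congr_ae (ae_of_all _ hsq)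
  rw [h1, hvar] at hmain
  have h3 : ∫ U, dens G r x (torusLift (2 * L + 1) U) * dens G r x (torusLift (2 * L + 1) U) ∂μT =
      ∫ U, dens G r x (torusLift (2 * L + 1) U) ^ 2 ∂μT := integral_congr_ae (ae_of_all _ fun U => by ring)
  simp only [torusE]
  rw [← hmD, h3]
  have e2 : mD ^ 2 = mD * mD := sq mD
  linarith [hmain, e2]

/-- **THE TWO-SIDED PIN OF THE DIAGONAL OF `torusCov` for compact SIMPLE gauge groups**: `c/β² ≤ torusCov_{T,β}(x, x) ≤ W/β²`
for all `β ≥ β₀`, all odd tori `2L+1 ≥ 5`, all sites (floor: this file; ceiling: g28's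
`SharpCeilings.exists_abs_torusCov_dens_le_sharp`). [folklore] -/
theorem torusCov_dens_diag_pin_of_simple (hG : IsCompactSimpleLieGroup G) :
    ∃ c W β₀ : ℝ, 0 < c ∧ c ≤ W ∧ 0 < β₀ ∧ ∀ β : ℝ, β₀ ≤ β → ∀ (L : ℕ), 2 ≤ L → ∀ x : Fin 4 → ℤ,
      c / β ^ 2 ≤ torusE G r β L (fun U => dens G r x U * dens G r x U) -
          torusE G r β L (dens G r x) * torusE G r β L (dens G r x) ∧
      torusE G r β L (fun U => dens G r x U * dens G r x U) -
          torusE G r β L (dens G r x) * torusE G r β L (dens G r x) ≤ W / β ^ 2 := by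
  obtain ⟨c, β₀, hc, hβ₀, hfloor⟩ := exists_torusCov_dens_diag_ge G r (dimE_pos_of_isCompactSimpleLieGroup G r hG)
  obtain ⟨W, hW0, hW⟩ := Summit.QuantumFields.YangMills.Cruxes.NT.SharpCeilings.exists_abs_torusCov_dens_le_sharp (G := G) r
  refine ⟨c, max c W, max β₀ 4, hc, le_max_left _ _, lt_of_lt_of_le hβ₀ (le_max_left _ _), fun β hβ L hL x => ?_⟩
  have hββ₀ : β₀ ≤ β := (le_max_left _ _).trans hβ
  have hβ4 : 4 ≤ β := (le_max_right _ _).trans hβ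
  refine ⟨hfloor β hββ₀ L hL x, ?_⟩
  have h := (abs_le.1 (hW L (le_trans one_le_two hL) β hβ4 x x)).2
  exact h.trans (div_le_div_of_nonneg_right (le_max_right _ _) (by positivity))

end TorusCov

/-! ## §3 The link action: `c/β² ≤ Var_{T,β}(S_e)` -/

section LinkAction

set_option maxHeartbeats 400000 in
/-- **Variance floor of the link action**: there are `c, β₀ > 0` with `c/β² ≤ Var_{T,β}(S_e ∘ lift)` for every `β ≥ β₀`, every odd
torus `2L+1 ≥ 5` and every link `e` of `ℤ⁴` (`S_e = Σ_{p ∋ e} (N − Re tr r(U_p))`, six plaquettes). [folklore] -/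
theorem exists_torusVar_linkAction_ge (hD : 0 < dimE r.ρ) :
    ∃ c β₀ : ℝ, 0 < c ∧ 0 < β₀ ∧ ∀ β : ℝ, β₀ ≤ β → ∀ (L : ℕ), 2 ≤ L → ∀ e : ZdEdge 4,
      c / β ^ 2 ≤ torusE G r β L (fun U => (wilsonBoundaryAction r.ρ {e} U - torusE G r β L (wilsonBoundaryAction r.ρ {e})) ^ 2) := by
  classical
  haveI := r.secondCountableTopology
  obtain ⟨θ, hθ0, hgood⟩ := exists_good_exteriors G r
  obtain ⟨κ, β₁, hκ, hβ₁, hker⟩ := kernel_variance_floor r.ρ r.continuous r.injective r.mem_unitary hD θ hθ0.le 6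
  refine ⟨κ / 2, max β₁ 4, by positivity, lt_of_lt_of_le hβ₁ (le_max_left _ _), fun β hβ L hL e => ?_⟩
  have hββ₁ : β₁ ≤ β := (le_max_left _ _).trans hβ
  have hβ4 : 4 ≤ β := (le_max_right _ _).trans hβ
  haveI : NeZero (2 * L + 1) := ⟨by omega⟩
  set μT := wilsonMeasure (d := 4) (L := 2 * L + 1) (G := G) r.ρ β with hμT
  haveI : IsProbabilityMeasure μT := isProbabilityMeasure_wilsonMeasure (d := 4) (L := 2 * L + 1) r.ρ r.continuous β
  obtain ⟨x, i⟩ := e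
  set e : ZdEdge 4 := (x, i) with he
  set F : LGConfig 4 G → ℝ := wilsonBoundaryAction r.ρ {e} with hF
  have hFcont : Continuous F := continuous_wilsonBoundaryAction r.ρ r.continuous {e}
  have hFbd := abs_wilsonBoundaryAction_singleton_le r.ρ r.mem_unitary e
  set m : ℝ := torusE G r β L F with hm
  have hmabs : |m| ≤ ((2 * (4 - 1) : ℕ) : ℝ) * (2 * (r.N : ℝ)) := by
    have h := norm_integral_le_of_norm_le_const (μ := μT) (f := fun U => F (torusLift (2 * L + 1) U))
      (C := ((2 * (4 - 1) : ℕ) : ℝ) * (2 * (r.N : ℝ))) (ae_of_all _ fun U => by rw [Real.norm_eq_abs]; exact hFbd _)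
    rw [hm]
    simpa [Real.norm_eq_abs, torusE] using h
  have hcard : (plaquettesTouching {e}).card ≤ 6 := (card_plaquettesTouching_singleton_le e).trans (by norm_num)
  haveI : Nonempty ↥(plaquettesTouching {e}) := (plaquettesTouching_singleton_nonempty e).coe_sort
  have hcard' : Fintype.card ↥(plaquettesTouching {e}) ≤ 6 := by rwa [Fintype.card_coe]
  have hfloor : ∀ U ∈ {U : GaugeConfig 4 (2 * L + 1) G |
      wilsonBoundaryAction r.ρ {e} (torusLift (2 * L + 1) U) ≤ θ / β ∧
        ∫ V, wilsonBoundaryAction r.ρ {e} V ∂(ymSpecification r.ρ β {e} (torusLift (2 * L + 1) U)) ≤ θ / β},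
      κ / β ^ 2 ≤ ∫ V, (F V - m) ^ 2 ∂(ymSpecification r.ρ β {e} (torusLift (2 * L + 1) U)) := by
    intro U hU
    set ω := torusLift (2 * L + 1) U with hω
    have hk0 : linkCost r.ρ (fun p : ↥(plaquettesTouching {e}) => staple p.1 e ω) (ω e) ≤ θ / β := by
      rw [← wilsonBoundaryAction_update_eq_linkCost r.ρ r.mem_unitary e ω (ω e), Function.update_eq_self]
      exact hU.1
    exact hker β hββ₁ e ω (plaquettesTouching_singleton_nonempty e) hcard ↥(plaquettesTouching {e})
      (fun p : ↥(plaquettesTouching {e}) => staple p.1 e ω) hcard' F 0 hFcont.measurable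
      (fun g => by rw [add_zero]; exact wilsonBoundaryAction_update_eq_linkCost r.ρ r.mem_unitary e ω g)
      hU.1 hk0 hU.2 m
  have hGm : MeasurableSet {U : GaugeConfig 4 (2 * L + 1) G |
      wilsonBoundaryAction r.ρ {e} (torusLift (2 * L + 1) U) ≤ θ / β ∧
        ∫ V, wilsonBoundaryAction r.ρ {e} V ∂(ymSpecification r.ρ β {e} (torusLift (2 * L + 1) U)) ≤ θ / β} :=
    ((isClosed_le ((continuous_wilsonBoundaryAction r.ρ r.continuous {e}).comp (continuous_torusLift _))
        continuous_const).inter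
      (isClosed_le ((continuous_integral_ymSpecification r.ρ r.continuous β {e}
        (continuous_wilsonBoundaryAction r.ρ r.continuous {e})
        (abs_wilsonBoundaryAction_singleton_le r.ρ r.mem_unitary e)).comp (continuous_torusLift _))
        continuous_const)).measurableSet
  exact torus_integral_ge_of_good G r e hFcont hFbd (isCylinder_wilsonBoundaryAction_holds r.ρ {e}) (fun j => x j - 2)
    (window_of_touching hL x i) m hmabs hκ.le hGm (hgood L hL β hβ4 x i) hfloor

end LinkAction

end Summit.QuantumFields.YangMills.Cruxes.NT.LinkEquipartition

end
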